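import Literature.AlgebraicGeometry.Hu2025.Statements.S04ModelV.R103cClaims

/-!
# Hu 2025 (arXiv:2507.21400v1, Part I), §4.2.2 — READING R3 of Def. 4.11 ‹chunk 4.10› («no cancellation in the descendant
# `f̄`») with the two in-text claims along it: PARTITION-HU row 103, file d (`S04ModelV/R103dReadingR3.lean`), additive reading
# siblings of file b's `…R2` decls and file c's `C23L47_R2`; STATEMENTS-FIRST (LADDER-RESOLUTION rung M-Hu-min, D-0089)

Text of record: chunk p0022 l.153–173 and p0023 l.35–48 of `paper:arxiv-2507.21400`; PDF cross-check
`lit/res-lit-6/hu25/text/hu25_p049.txt` L019–L033, `hu25_p050.txt` L022–L027. Typer of record res-type-042 (row 103), every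
locator re-read on the chunk and the PDF text (T9). NOTHING from the preprint is asserted: `def … : Prop` CANDIDATE STATEMENTS
tagged `[claim: Hu2025, status: under-review]`; no proofs, no `sorry`, no `instance`, no notation. Accepted files a/b/c are
untouched (T7). HONEST CEILING (PARTITION-HU header): Part I as printed claims resolution of singularity TYPES; the summit-type
claim rests on the UNPOSTED Part II. AI typing/adjudication is weaker than expert review.

WHY A THIRD READING (for the faithfulness lanes and res-adj; a choice, no side taken). Def. 4.11 ‹4.10› (chunk p0022
l.154–162): «Let `f = Σ_i x_(u_i,v_i) 𝐧_i ∈ R_[k] (⊂ R)` be a multi-homogeneous expression/polynomial, written as above,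
which is allowed to be zero … Set `f̄ = Σ_i x_{u_i} x_{v_i} 𝐧_i ∈ R_[k]`. Then, we call `f` a parent of `f̄`». File b types
the WRITTEN side in two readings (R1: cofactors `n_i` arbitrary, res-type-044; R2: `𝐧_i` terms with one common multidegree,
res-type-042); both put NO condition on the descended side `f̄`. The kernel files `Proofs/S04ModelV/RootParents.lean` /
`RootParentsPlatformSix.lean` (res-type-042, p524595 / p525291) show that with `f̄` unrestricted the remark after Ex. 4.14
‹4.13› «a ℘-binomial does not admit any non-zero root parent» (file c `C23L47` / `C23L47_R2`) fails AS TYPED at the platform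
`Gr^{3,6}`, through expressions whose DESCENDED summands cancel. The printed Ex. 4.14 (chunk p0023 l.35–45) uses an
expression whose WRITTEN summands cancel («(which is zero as a binomial)») and whose descended summands are the two distinct
monomials of the ℘-binomial. READING R3 (this file) = R2 + «the descended summands `x_{u_i}x_{v_i}𝐧_i` are pairwise distinct
monomials with non-zero coefficients» — `f̄` is written, like `f` «as above» (chunk p0021 l.167 «We express it as the sum of its
monomials»), without cancellation. Ex. 4.14 is an R3 step; under R3 the companion kernel file shows the remark holds at the
platform. Which reading the sentence p0023 l.47–48 needs is a question about the text, recorded by typing all three.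

Carriers: files a/b (`ModelRing`, `RSub`, `IsMultiHomogeneous`, `monoR`, `kerMH`, `wpBinomials`, `exprSummand`,
`exprSummandBar`, `IsMHExpression`).
-/

noncomputable section

namespace Literature.AlgebraicGeometry.Hu2025.Statements.S04ModelV

open MvPolynomial

universe u v w x

variable {k : Type u} [CommRing k] {σ : Type v} {T : Type w} {𝔗 : Type x}
variable (rel : T → 𝔗) (mono : T → (σ →₀ ℕ))

/-- **Hu 2025, Def. 4.11 ‹chunk Definition 4.10›, ONE DESCENT STEP at the block `F` — reading R3 («no cancellation in
`f̄`»)** (chunk p0022 l.153–162; PDF p.49 L019–L027), verbatim as for `IsDescentStepR2`: «Let `f = Σ_i x_(u_i,v_i) 𝐧_i ∈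
R_[k] (⊂ R)` be a multi-homogeneous expression/polynomial, written as above, which is allowed to be zero … Set `f̄ = Σ_i
x_{u_i} x_{v_i} 𝐧_i ∈ R_[k]`. Then, we call `f` a parent of `f̄` and `f̄` a descendant of `f`.» — the term-wise
multi-homogeneous expression of reading R2 (`IsMHExpression`: `𝐧_i` terms `c_i x^{a_i}`, `rel t_i = F`, summands in `R_Φ`,
one common multidegree) with, IN ADDITION, non-zero coefficients `c_i` and PAIRWISE DISTINCT descended monomials
`x̄_{t_i} x^{a_i}` (exponents `monoR mono t_i + a_i`), i.e. `f̄` is written «as the sum of its monomials» (chunk p0021 l.167)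
without cancellation; the written side may still cancel («allowed to be zero», Ex. 4.14). Sibling of `IsDescentStep` (R1)
and `IsDescentStepR2` (R2); labelled READING (PARTITION-HU §6 (e)). [claim: Hu2025, status: under-review]
STATUS: candidate statement under adjudication (D-0012/D-0089); not asserted. -/
def IsDescentStepR3 [DecidableEq 𝔗] (Φ : Set 𝔗) (F : 𝔗) (f g : ModelRing σ T k) : Prop :=
  ∃ l : List (T × (σ ⊕ T →₀ ℕ) × k), IsMHExpression (k := k) (σ := σ) rel Φ F l ∧
    (∀ p ∈ l, p.2.2 ≠ 0) ∧ (l.map fun p => monoR mono p.1 + p.2.1).Nodup ∧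
    f = (l.map (exprSummand (k := k) (σ := σ))).sum ∧
    g = (l.map (exprSummandBar (k := k) (σ := σ) mono)).sum

/-- **Hu 2025, Def. 4.11 ‹4.10›, «`f` is a parent of `g`» — reading R3** (chunk p0022 l.162–165; PDF p.49 L027–L029): the
reflexive–transitive closure of `IsDescentStepR3` (at any block); sibling of `IsParentOf` (R1), `IsParentOfR2` (R2).
[claim: Hu2025, status: under-review]
STATUS: candidate statement under adjudication (D-0012/D-0089); not asserted. -/
def IsParentOfR3 [DecidableEq 𝔗] (Φ : Set 𝔗) (f g : ModelRing σ T k) : Prop :=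
  Relation.ReflTransGen
    (fun f' g' : ModelRing σ T k => ∃ F : 𝔗, IsDescentStepR3 (k := k) rel mono Φ F f' g') f g

/-- **Hu 2025, Def. 4.11** — numbered alias of `IsParentOfR3` (reading R3 of PDF Def. 4.11 = chunk «Definition 4.10»,
p0022 l.153–173; p.49). [claim: Hu2025, status: under-review]
STATUS: candidate statement under adjudication (D-0012/D-0089); not asserted. -/
abbrev Def4_11_R3 [DecidableEq 𝔗] (Φ : Set 𝔗) (f g : ModelRing σ T k) : Prop :=
  IsParentOfR3 (k := k) rel mono Φ f g

/-- **Hu 2025, Def. 4.11 ‹4.10›, root polynomial — reading R3** (chunk p0022 l.167–169; PDF p.49 L030–L031), verbatim: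
«if a multi-homogeneous polynomial `f ∈ R_{[k]}` does not admit any parent other than itself, then we say `f` is root
polynomial.» — along `IsParentOfR3`; sibling of `IsRootPolynomial` (R1), `IsRootPolynomialR2` (R2).
[claim: Hu2025, status: under-review]
STATUS: candidate statement under adjudication (D-0012/D-0089); not asserted. -/
def IsRootPolynomialR3 [DecidableEq 𝔗] (Φ : Set 𝔗) (f : ModelRing σ T k) : Prop :=
  f ∈ RSub (k := k) rel Φ ∧ IsMultiHomogeneous (k := k) (σ := σ) rel f ∧
    ∀ g : ModelRing σ T k, IsParentOfR3 (k := k) rel mono Φ g f → g = f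

/-- **Hu 2025, Def. 4.11 ‹4.10›, root parent — reading R3** (chunk p0022 l.170–171; PDF p.49 L031–L032): «`f` is a root
parent of `g` if it is a root polynomial and a parent of `g`», along the R3 relations; sibling of `IsRootParentOf` (R1),
`IsRootParentOfR2` (R2). [claim: Hu2025, status: under-review]
STATUS: candidate statement under adjudication (D-0012/D-0089); not asserted. -/
def IsRootParentOfR3 [DecidableEq 𝔗] (Φ : Set 𝔗) (f g : ModelRing σ T k) : Prop :=
  IsRootPolynomialR3 (k := k) rel mono Φ f ∧ IsParentOfR3 (k := k) rel mono Φ f g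

/-- **Hu 2025, unnumbered claim chunk p0022 l.173; PDF p.49 L033 — reading R3**, verbatim: «One sees that if `f` belongs
to `ker^{mh} φ_{[k]}` if and only if any of its descendant does.» — along `IsParentOfR3 Φ`. Sibling of `C22L173` (R1),
`C22L173_R2` (R2). Typed claim. [claim: Hu2025, status: under-review]
STATUS: candidate statement under adjudication (D-0012/D-0089); not asserted. -/
def C22L173_R3 [DecidableEq 𝔗] (Φ : Set 𝔗) : Prop :=
  ∀ f g : ModelRing σ T k, IsParentOfR3 (k := k) rel mono Φ f g →
    (f ∈ kerMH (k := k) rel mono Φ ↔ g ∈ kerMH (k := k) rel mono Φ)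

/-- **Hu 2025, in-text claim after Ex. 4.14 ‹chunk Ex. 4.13› — reading R3** (chunk p0023 l.47–48; PDF p.50 L027),
verbatim: «It is not hard to see that a ℘-binomial does not admit any non-zero root parent.» — every R3 root parent
(`IsRootParentOfR3 Φ`) of a member of `B^℘_[k]` is `0`. Sibling of `C23L47` (R1) and `C23L47_R2` (R2) of file c. Typed
claim. [claim: Hu2025, status: under-review]
STATUS: candidate statement under adjudication (D-0012/D-0089); not asserted. -/
def C23L47_R3 [DecidableEq 𝔗] (Φ : Set 𝔗) : Prop :=
  ∀ b ∈ wpBinomials (k := k) (σ := σ) rel mono Φ, ∀ f : ModelRing σ T k,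
    IsRootParentOfR3 (k := k) rel mono Φ f b → f = 0

end Literature.AlgebraicGeometry.Hu2025.Statements.S04ModelV

end
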